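/-
Copyright (c) 2026. All rights reserved.
Released under Apache 2.0 license as described in the file LICENSE.
Authors: abc-iut cell, seat abc-iut-w5-d019 (gen 8).
-/
import Literature.GroupTheory.ProPPowerMap
import Mathlib.GroupTheory.Commutator.Basic
import Mathlib.Algebra.Group.Pointwise.Set.ListOfFn

/-!
# A profinite group whose finite quotients have uniformly bounded commutator width has a closed
# (indeed compact) derived subgroup

B. Hartley, *Subgroups of finite index in profinite groups*, Math. Z. 168 (1979) 71–76, §1 (the
remark recorded by Nikolov–Segal, Ann. of Math. 165 (2007), §1, before Thm 1.6): for a profinite group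
`M` and `B ∈ ℕ`, the set `C_B(M)` of products of `B` commutators is compact, and
`[M, M] = C_B(M)` holds if and only if `[M ⧸ U, M ⧸ U] = C_B(M ⧸ U)` for every open normal subgroup `U`;
in that case the ABSTRACT derived subgroup `[M, M]` is closed.  We prove the useful direction:

* `closure_commutator_subset_powProd` — if every element of `[M ⧸ U, M ⧸ U]` is a product of `B`
  commutators for every open normal `U`, then `closure [M, M] ⊆ C_B(M)`;
* `commutator_eq_powProd_of_forall_quotient`, `isCompact_commutator_of_forall_quotient`,
  `isClosed_commutator_of_forall_quotient` — hence `[M, M] = C_B(M)` is compact and closed.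

`C_B(M)` is spelled out as the pointwise product of the list `List.replicate B {⁅x, y⁆ | x y}` (no
definition is introduced); `listProd_commSet_subset_powProd` converts the "relative generator" width
sets `{⁅y₁,c₁⁆⋯⁅y_k,c_k⁆ | yᵢ ∈ Eᵢ}` of `CommutatorWidthLowerCentral.lean` /
`CommutatorWidthNilpotentNormal.lean` into this shape.  The proof is the compactness argument of the
tree's `ProPDerivedClosed.lean` (seat abc-iut-w5-d218) with the nilpotent width lemma replaced by the
hypothesis.

Consumer (cell abc-iut, GAP-LEDGER G-L3d2g2-1): closedness of the derived subgroup of every open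
subgroup of the absolute Galois group of a `p`-adic field (finite quotients `Gal(E/k)` are
nilpotent-by-metacyclic with uniformly bounded commutator width), the input of the derived-series
descent proving strong completeness.  Classical; no definition, no instance; nothing here bears on
[IUTchIII] Cor. 3.12 or asserts anything about abc.

[cite: NikolovSegal2007, §1 (before Thm 1.6)] [cite: DDMSAnalyticProP1999, Prop 1.19 (proof)]
-/

namespace Literature.GroupTheory

namespace BoundedCommutatorWidth

open scoped Pointwise commutatorElement

section Algebra

variable {M : Type*} [Group M]

/-- `1 ∈ C_B(M)`. [cite: NikolovSegal2007, §1 (before Thm 1.6)] -/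
theorem one_mem_powProd (B : ℕ) :
    (1 : M) ∈ (List.replicate B {c : M | ∃ x y : M, ⁅x, y⁆ = c}).prod := by
  induction B with
  | zero => simp
  | succ B ih =>
    rw [List.replicate_succ, List.prod_cons]
    exact Set.mem_mul.mpr ⟨1, ⟨1, 1, commutatorElement_one_left 1⟩, 1, ih, one_mul 1⟩

/-- `C_B(M) ⊆ [M, M]`. [cite: NikolovSegal2007, §1 (before Thm 1.6)] -/
theorem powProd_subset_commutator (B : ℕ) :
    (List.replicate B {c : M | ∃ x y : M, ⁅x, y⁆ = c}).prod ⊆ (commutator M : Set M) := by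
  induction B with
  | zero =>
    rw [List.replicate_zero, List.prod_nil]
    intro g hg
    rw [Set.mem_one] at hg
    rw [hg]
    exact (commutator M).one_mem
  | succ B ih =>
    rw [List.replicate_succ, List.prod_cons]
    intro g hg
    obtain ⟨c, ⟨x, y, rfl⟩, u, hu, rfl⟩ := Set.mem_mul.mp hg
    exact (commutator M).mul_mem
      (Subgroup.commutator_mem_commutator (Subgroup.mem_top x) (Subgroup.mem_top y)) (ih hu)

/-- `C_B(M) ⊆ C_{B'}(M)` for `B ≤ B'` (pad with trivial commutators).
[cite: NikolovSegal2007, §1 (before Thm 1.6)] -/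
theorem powProd_mono {B B' : ℕ} (h : B ≤ B') :
    (List.replicate B {c : M | ∃ x y : M, ⁅x, y⁆ = c}).prod ⊆
      (List.replicate B' {c : M | ∃ x y : M, ⁅x, y⁆ = c}).prod := by
  obtain ⟨k, rfl⟩ := Nat.exists_eq_add_of_le h
  rw [add_comm, List.replicate_add, List.prod_append]
  intro g hg
  exact Set.mem_mul.mpr ⟨1, one_mem_powProd k, g, hg, one_mul g⟩

/-- A surjective homomorphism maps `C_B` onto `C_B`. [cite: NikolovSegal2007, §1 (before Thm 1.6)] -/
theorem image_powProd {Q : Type*} [Group Q] (f : M →* Q) (hf : Function.Surjective f) (B : ℕ) :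
    f '' (List.replicate B {c : M | ∃ x y : M, ⁅x, y⁆ = c}).prod =
      (List.replicate B {c : Q | ∃ x y : Q, ⁅x, y⁆ = c}).prod := by
  induction B with
  | zero => simp [Set.singleton_one]
  | succ B ih =>
    rw [List.replicate_succ, List.prod_cons, List.replicate_succ, List.prod_cons, Set.image_mul,
      ih]
    congr 1
    ext c
    constructor
    · rintro ⟨c', ⟨x, y, rfl⟩, rfl⟩
      exact ⟨f x, f y, (map_commutatorElement f x y).symm⟩
    · rintro ⟨x, y, rfl⟩
      obtain ⟨x', rfl⟩ := hf x
      obtain ⟨y', rfl⟩ := hf y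
      exact ⟨⁅x', y'⁆, ⟨x', y', rfl⟩, map_commutatorElement f x' y'⟩

/-- The "relative generator" width sets are contained in `C_B`: a product
`⁅y₁,c₁⁆ ⋯ ⁅y_k,c_k⁆` over a list `w` of pairs `(cᵢ, Eᵢ)` with `yᵢ ∈ Eᵢ` is a product of
`w.length` commutators. [cite: DDMSAnalyticProP1999, Prop 1.19 (proof)] -/
theorem listProd_commSet_subset_powProd (w : List (M × Subgroup M)) :
    (w.map fun p : M × Subgroup M => (fun y : M => ⁅y, p.1⁆) '' (p.2 : Set M)).prod ⊆
      (List.replicate w.length {c : M | ∃ x y : M, ⁅x, y⁆ = c}).prod := by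
  induction w with
  | nil => simp
  | cons p w ih =>
    rw [List.map_cons, List.prod_cons, List.length_cons, List.replicate_succ, List.prod_cons]
    intro g hg
    obtain ⟨c, ⟨y, _, rfl⟩, u, hu, rfl⟩ := Set.mem_mul.mp hg
    exact Set.mem_mul.mpr ⟨⁅y, p.1⁆, ⟨y, p.1, rfl⟩, u, ih hu, rfl⟩

/-- The width sets with a generating LIST (shape of `CommutatorWidthLowerCentral.lean`:
`{⁅x₁,a₁⁆⋯⁅x_d,a_d⁆ | xᵢ ∈ K}`) are contained in `C_d`. [cite: DDMSAnalyticProP1999, Prop 1.19 (proof)] -/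
theorem listProd_commSet_subset_powProd' (K : Subgroup M) (l : List M) :
    (l.map fun a => (fun y : M => ⁅y, a⁆) '' (K : Set M)).prod ⊆
      (List.replicate l.length {c : M | ∃ x y : M, ⁅x, y⁆ = c}).prod := by
  induction l with
  | nil => simp
  | cons a l ih =>
    rw [List.map_cons, List.prod_cons, List.length_cons, List.replicate_succ, List.prod_cons]
    intro g hg
    obtain ⟨c, ⟨y, _, rfl⟩, u, hu, rfl⟩ := Set.mem_mul.mp hg
    exact Set.mem_mul.mpr ⟨⁅y, a⁆, ⟨y, a, rfl⟩, u, ih hu, rfl⟩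

end Algebra

section Topology

variable {M : Type*} [Group M] [TopologicalSpace M] [IsTopologicalGroup M] [CompactSpace M]

/-- `C_B(M)` is compact in a compact topological group. [cite: NikolovSegal2007, §1 (before Thm 1.6)] -/
theorem isCompact_powProd (B : ℕ) :
    IsCompact (List.replicate B {c : M | ∃ x y : M, ⁅x, y⁆ = c}).prod := by
  induction B with
  | zero => rw [List.replicate_zero, List.prod_nil, ← Set.singleton_one]; exact isCompact_singleton
  | succ B ih =>
    rw [List.replicate_succ, List.prod_cons]
    refine IsCompact.mul ?_ ih
    have hc : Continuous fun q : M × M => ⁅q.1, q.2⁆ := by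
      simp only [commutatorElement_def]; fun_prop
    have : {c : M | ∃ x y : M, ⁅x, y⁆ = c} = Set.range fun q : M × M => ⁅q.1, q.2⁆ := by
      ext c; constructor
      · rintro ⟨x, y, rfl⟩; exact ⟨(x, y), rfl⟩
      · rintro ⟨q, rfl⟩; exact ⟨q.1, q.2, rfl⟩
    rw [this]
    exact isCompact_range hc

variable [TotallyDisconnectedSpace M]

/-- **Bounded width in the finite quotients bounds the closure of the derived subgroup.**  If for
every open normal `U` every element of `[M ⧸ U, M ⧸ U]` is a product of `B` commutators, then
`closure [M, M] ⊆ C_B(M)`: for each `U`, `closure [M,M] ⊆ [M,M]·U`, the image of `[M,M]` in `M ⧸ U`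
lies in `C_B(M ⧸ U)` = image of `C_B(M)`, so `closure [M,M] ⊆ ⋂_U C_B(M)·U = C_B(M)` by compactness.
[cite: NikolovSegal2007, §1 (before Thm 1.6)] -/
theorem closure_commutator_subset_powProd {B : ℕ}
    (hB : ∀ U : OpenNormalSubgroup M, (commutator (M ⧸ (U : Subgroup M)) : Set (M ⧸ (U : Subgroup M))) ⊆
      (List.replicate B {c : M ⧸ (U : Subgroup M) | ∃ x y : M ⧸ (U : Subgroup M), ⁅x, y⁆ = c}).prod) :
    closure (commutator M : Set M) ⊆ (List.replicate B {c : M | ∃ x y : M, ⁅x, y⁆ = c}).prod := by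
  intro g hg
  refine mem_of_forall_mem_mul_openNormalSubgroup (isCompact_powProd B).isClosed fun U => ?_
  -- `g ∈ [M,M] ⊔ U`, an open (hence closed) subgroup containing `[M,M]`
  have hsup : g ∈ commutator M ⊔ (U : Subgroup M) := by
    have hopen : IsOpen ((commutator M ⊔ (U : Subgroup M) : Subgroup M) : Set M) :=
      Subgroup.isOpen_mono le_sup_right U.isOpen
    have hcl : IsClosed ((commutator M ⊔ (U : Subgroup M) : Subgroup M) : Set M) :=
      Subgroup.isClosed_of_isOpen _ hopen
    exact (hcl.closure_subset_iff.mpr (SetLike.coe_subset_coe.mpr le_sup_left)) hg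
  obtain ⟨c, hc, u, hu, rfl⟩ := Subgroup.mem_sup_of_normal_right.mp hsup
  -- the image of `c` is a product of `B` commutators in `M ⧸ U`, i.e. the image of an element of `C_B(M)`
  have hcQ : (QuotientGroup.mk' (U : Subgroup M)) c ∈ commutator (M ⧸ (U : Subgroup M)) := by
    have h1 : (commutator M).map (QuotientGroup.mk' (U : Subgroup M)) ≤
        commutator (M ⧸ (U : Subgroup M)) := by
      rw [commutator, commutator, Subgroup.map_commutator]
      exact Subgroup.commutator_mono le_top le_top
    exact h1 (Subgroup.mem_map_of_mem _ hc)
  have hcT : (QuotientGroup.mk' (U : Subgroup M)) c ∈ (QuotientGroup.mk' (U : Subgroup M)) ''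
      (List.replicate B {c : M | ∃ x y : M, ⁅x, y⁆ = c}).prod := by
    rw [image_powProd _ (QuotientGroup.mk'_surjective _)]
    exact hB U hcQ
  obtain ⟨w, hw, hwc⟩ := hcT
  have hwc' : w⁻¹ * c ∈ (U : Subgroup M) := QuotientGroup.eq.mp hwc
  exact Set.mem_mul.mpr ⟨w, hw, w⁻¹ * c * u, mul_mem hwc' hu, by group⟩

/-- **Uniformly bounded commutator width in the finite quotients ⇒ `[M, M] = C_B(M)`.**
[cite: NikolovSegal2007, §1 (before Thm 1.6)] -/
theorem commutator_eq_powProd_of_forall_quotient {B : ℕ}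
    (hB : ∀ U : OpenNormalSubgroup M, (commutator (M ⧸ (U : Subgroup M)) : Set (M ⧸ (U : Subgroup M))) ⊆
      (List.replicate B {c : M ⧸ (U : Subgroup M) | ∃ x y : M ⧸ (U : Subgroup M), ⁅x, y⁆ = c}).prod) :
    (commutator M : Set M) = (List.replicate B {c : M | ∃ x y : M, ⁅x, y⁆ = c}).prod :=
  Set.Subset.antisymm (subset_closure.trans (closure_commutator_subset_powProd hB))
    (powProd_subset_commutator B)

/-- **Uniformly bounded commutator width in the finite quotients ⇒ the derived subgroup is compact.**
[cite: NikolovSegal2007, §1 (before Thm 1.6)] -/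
theorem isCompact_commutator_of_forall_quotient {B : ℕ}
    (hB : ∀ U : OpenNormalSubgroup M, (commutator (M ⧸ (U : Subgroup M)) : Set (M ⧸ (U : Subgroup M))) ⊆
      (List.replicate B {c : M ⧸ (U : Subgroup M) | ∃ x y : M ⧸ (U : Subgroup M), ⁅x, y⁆ = c}).prod) :
    IsCompact (commutator M : Set M) := by
  rw [commutator_eq_powProd_of_forall_quotient hB]
  exact isCompact_powProd B

/-- **Uniformly bounded commutator width in the finite quotients ⇒ the (abstract) derived subgroup is
closed.** [cite: NikolovSegal2007, §1 (before Thm 1.6)] -/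
theorem isClosed_commutator_of_forall_quotient {B : ℕ}
    (hB : ∀ U : OpenNormalSubgroup M, (commutator (M ⧸ (U : Subgroup M)) : Set (M ⧸ (U : Subgroup M))) ⊆
      (List.replicate B {c : M ⧸ (U : Subgroup M) | ∃ x y : M ⧸ (U : Subgroup M), ⁅x, y⁆ = c}).prod) :
    IsClosed (commutator M : Set M) :=
  (isCompact_commutator_of_forall_quotient hB).isClosed

end Topology

end BoundedCommutatorWidth

end Literature.GroupTheory
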